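import Literature.Barriers.RiemannHypothesis.TuranPartialSumsCheckDefs
import Mathlib.Data.Nat.Prime.Basic
import Mathlib.Data.Nat.Factorization.Basic
import Mathlib.Data.List.Nodup
import HarnessLib

/-!
# Sections of `ζ` beyond `σ = 1`: soundness of the certificate checker, I (primitives)

Barrier catalogue `Literature/Barriers/RiemannHypothesis/`, companion of `TuranPartialSums.lean`
(the kernel-certificate part of the plan to prove `TuranPartialSums`). Pure proof file (nothing is
defined or asserted). This part gives the meaning of the primitives of `TuranPartialSumsCheck.lean`:
bridging lemmas for the kernel arithmetic (`Nat.beq`, `Nat.ble`, `Nat.blt`), `isPrimeTD_sound`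
(trial division), `validGo_sound` / `validEntries_sound` (the keys are strictly increasing primes,
`x² + y² = d² > 0`), `isKey_iff`, `keyDvd_iff`, `smallPrimesIn_sound` (every prime `p` with `p² ≤ N`
is a key) and `bigM_pos`. Continued in `TuranPartialSumsCheckStrip.lean` (phases and stripping),
`TuranPartialSumsCheckInv.lean`, `TuranPartialSumsCheckStep.lean`, `TuranPartialSumsCheckSound.lean`
(the main loop and the verdict).

## References

* [PlattTrudgian2016] D. J. Platt, T. S. Trudgian, LMS J. Comput. Math. 19 (2016), §2.
-/

namespace Literature.Barriers.RiemannHypothesis.TuranCheck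

open Literature.Barriers.RiemannHypothesis Complex

/-! ### Bridging the kernel primitives -/

/-- `Nat.add = (+)`. [folklore] -/ theorem nat_add_eq (a b : ℕ) : Nat.add a b = a + b := rfl
/-- `Nat.mul = (*)`. [folklore] -/ theorem nat_mul_eq (a b : ℕ) : Nat.mul a b = a * b := rfl
/-- `Nat.sub = (-)`. [folklore] -/ theorem nat_sub_eq (a b : ℕ) : Nat.sub a b = a - b := rfl
/-- `Nat.div = (/)`. [folklore] -/ theorem nat_div_eq' (a b : ℕ) : Nat.div a b = a / b := rfl
/-- `Nat.mod = (%)`. [folklore] -/ theorem nat_mod_eq' (a b : ℕ) : Nat.mod a b = a % b := rfl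
/-- `Nat.pow = (^)`. [folklore] -/ theorem nat_pow_eq' (a b : ℕ) : Nat.pow a b = a ^ b := rfl
/-- `Int.add = (+)`. [folklore] -/ theorem int_add_eq (a b : ℤ) : Int.add a b = a + b := rfl
/-- `Int.mul = (*)`. [folklore] -/ theorem int_mul_eq (a b : ℤ) : Int.mul a b = a * b := rfl
/-- `Int.sub = (-)`. [folklore] -/ theorem int_sub_eq (a b : ℤ) : Int.sub a b = a - b := rfl

/-- `Nat.beq a b = true ↔ a = b`. [folklore] -/
theorem beq_true_iff {a b : ℕ} : Nat.beq a b = true ↔ a = b := by rw [Nat.beq_eq]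
/-- `Nat.beq a b = false ↔ a ≠ b`. [folklore] -/
theorem beq_false_iff {a b : ℕ} : Nat.beq a b = false ↔ a ≠ b := by
  rw [Ne, ← Nat.beq_eq, Bool.not_eq_true]
/-- `Nat.ble a b = true ↔ a ≤ b`. [folklore] -/
theorem ble_true_iff {a b : ℕ} : Nat.ble a b = true ↔ a ≤ b := by rw [Nat.ble_eq]
/-- `Nat.ble a b = false ↔ ¬ a ≤ b`. [folklore] -/
theorem ble_false_iff {a b : ℕ} : Nat.ble a b = false ↔ ¬ a ≤ b := by
  rw [← Nat.ble_eq, Bool.not_eq_true]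
/-- `Nat.blt a b = true ↔ a < b`. [folklore] -/
theorem blt_true_iff {a b : ℕ} : Nat.blt a b = true ↔ a < b := by rw [Nat.blt_eq]
/-- `Nat.blt a b = false ↔ ¬ a < b`. [folklore] -/
theorem blt_false_iff {a b : ℕ} : Nat.blt a b = false ↔ ¬ a < b := by
  rw [← Nat.blt_eq, Bool.not_eq_true]

/-! ### Trial division -/

/-- If the trial-division loop from `d ≥ 1` answers `true`, no `m ≥ d` with `m² ≤ p` divides `p`.
[folklore] -/
private theorem tdGo_sound (p : ℕ) : ∀ fuel d : ℕ, 1 ≤ d → tdGo p fuel d = true →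
    ∀ m : ℕ, d ≤ m → m * m ≤ p → ¬ m ∣ p := by
  intro fuel
  induction fuel with
  | zero => intro d _ h; simp [tdGo] at h
  | succ fuel ih =>
    intro d hd h m hdm hmm hmp
    rw [tdGo] at h
    simp only [nat_mul_eq, nat_mod_eq', nat_add_eq] at h
    cases hlt : Nat.blt p (d * d) with
    | true =>
      rw [blt_true_iff] at hlt
      have : d * d ≤ m * m := Nat.mul_le_mul hdm hdm
      omega
    | false =>
      rw [hlt, cond_false] at h
      cases hdv : Nat.beq (p % d) 0 with
      | true => rw [hdv, cond_true] at h; exact Bool.false_ne_true h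
      | false =>
        rw [hdv, cond_false] at h
        rw [beq_false_iff] at hdv
        rcases eq_or_lt_of_le hdm with rfl | hlt'
        · exact hdv (Nat.mod_eq_zero_of_dvd hmp)
        · exact ih (d + 1) (by omega) h m hlt' hmm hmp

/-- **Trial division is sound**: `isPrimeTD p = true → p` is prime (private: the tree has the same
statement for another trial-division function, `SchoenfeldNumerics.prime_of_isPrimeTD`). [folklore] -/
private theorem isPrimeTD_sound {p : ℕ} (h : isPrimeTD p = true) : p.Prime := by
  rw [isPrimeTD, Bool.and_eq_true, ble_true_iff] at h
  rw [Nat.prime_def_le_sqrt]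
  refine ⟨h.1, fun m hm2 hms ↦ ?_⟩
  exact tdGo_sound p p 2 (by norm_num) h.2 m hm2 (Nat.le_sqrt.1 hms)

/-! ### Validity of the certificate -/

/-- What `validGo es prev = true` guarantees. [folklore] -/
theorem validGo_sound : ∀ (es : List (ℕ × ℤ × ℤ × ℕ)) (prev : ℕ), validGo es prev = true →
    (∀ e ∈ es, prev < e.1 ∧ e.1.Prime ∧ 0 < e.2.2.2 ∧
      e.2.1 * e.2.1 + e.2.2.1 * e.2.2.1 = (e.2.2.2 : ℤ) * e.2.2.2) ∧
    (es.map (·.1)).Pairwise (· < ·) := by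
  intro es
  induction es with
  | nil => intro prev _; simp
  | cons e es ih =>
    intro prev h
    obtain ⟨p, x, y, d⟩ := e
    rw [validGo] at h
    simp only [Bool.and_eq_true, blt_true_iff, int_add_eq, int_mul_eq, beq_iff_eq] at h
    obtain ⟨⟨⟨⟨hprev, hprime⟩, hd⟩, hxy⟩, hrest⟩ := h
    have hp := isPrimeTD_sound hprime
    obtain ⟨ih1, ih2⟩ := ih p hrest
    refine ⟨?_, ?_⟩
    · intro e he
      rcases List.mem_cons.1 he with rfl | he
      · exact ⟨hprev, hp, hd, by simpa using hxy⟩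
      · obtain ⟨h1, h2, h3, h4⟩ := ih1 e he
        exact ⟨hprev.trans h1, h2, h3, h4⟩
    · rw [List.map_cons, List.pairwise_cons]
      refine ⟨fun q hq ↦ ?_, ih2⟩
      obtain ⟨e, he, rfl⟩ := List.mem_map.1 hq
      exact (ih1 e he).1

/-- `validEntries es = true → Valid es`. [folklore] -/
theorem validEntries_sound {es : List (ℕ × ℤ × ℤ × ℕ)} (h : validEntries es = true) : Valid es := by
  obtain ⟨h1, h2⟩ := validGo_sound es 0 h
  exact ⟨fun e he ↦ (h1 e he).2.1, fun e he ↦ (h1 e he).2.2.1, fun e he ↦ (h1 e he).2.2.2, h2⟩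

/-- The tail of a valid certificate is valid. [folklore] -/
theorem Valid.tail {e : ℕ × ℤ × ℤ × ℕ} {es : List (ℕ × ℤ × ℤ × ℕ)} (h : Valid (e :: es)) :
    Valid es where
  prime e' he' := h.prime e' (List.mem_cons_of_mem _ he')
  den_pos e' he' := h.den_pos e' (List.mem_cons_of_mem _ he')
  pyth e' he' := h.pyth e' (List.mem_cons_of_mem _ he')
  pairwise := by
    have := h.pairwise
    rw [List.map_cons, List.pairwise_cons] at this
    exact this.2

/-- The head key of a valid certificate is not a key of the tail. [folklore] -/
theorem Valid.head_lt {e : ℕ × ℤ × ℤ × ℕ} {es : List (ℕ × ℤ × ℤ × ℕ)} (h : Valid (e :: es)) :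
    ∀ e' ∈ es, e.1 < e'.1 := by
  intro e' he'
  have := h.pairwise
  rw [List.map_cons, List.pairwise_cons] at this
  exact this.1 e'.1 (List.mem_map.2 ⟨e', he', rfl⟩)

/-- The keys of a valid certificate are pairwise distinct. [folklore] -/
theorem Valid.nodup_keys {es : List (ℕ × ℤ × ℤ × ℕ)} (h : Valid es) : (es.map (·.1)).Nodup :=
  h.pairwise.imp fun hab ↦ Nat.ne_of_lt hab

/-! ### Keys -/

/-- `isKey es p = true ↔ p` is a key. [folklore] -/
theorem isKey_iff : ∀ (es : List (ℕ × ℤ × ℤ × ℕ)) (p : ℕ),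
    isKey es p = true ↔ p ∈ es.map (·.1) := by
  intro es p
  induction es with
  | nil => simp [isKey]
  | cons e es ih =>
    obtain ⟨q, x, y, d⟩ := e
    rw [isKey, List.map_cons, List.mem_cons]
    cases hb : Nat.beq p q with
    | true => rw [beq_true_iff] at hb; simp [hb]
    | false => rw [beq_false_iff] at hb; simp [hb, ih]

/-- `keyDvd es p = true ↔` some key divides `p`. [folklore] -/
theorem keyDvd_iff : ∀ (es : List (ℕ × ℤ × ℤ × ℕ)) (p : ℕ),
    keyDvd es p = true ↔ ∃ q ∈ es.map (·.1), q ∣ p := by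
  intro es p
  induction es with
  | nil => simp [keyDvd]
  | cons e es ih =>
    obtain ⟨q, x, y, d⟩ := e
    rw [keyDvd]
    simp only [nat_mod_eq', List.map_cons, List.mem_cons, exists_eq_or_imp]
    cases hb : Nat.beq (p % q) 0 with
    | true =>
      rw [beq_true_iff] at hb
      simp [Nat.dvd_of_mod_eq_zero hb]
    | false =>
      rw [beq_false_iff] at hb
      have : ¬ q ∣ p := fun hq ↦ hb (Nat.mod_eq_zero_of_dvd hq)
      simp [this, ih]

/-- What `spGo N es fuel p = true` guarantees. [folklore] -/
theorem spGo_sound (N : ℕ) (es : List (ℕ × ℤ × ℤ × ℕ)) : ∀ fuel p : ℕ, spGo N es fuel p = true →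
    ∀ q : ℕ, p ≤ q → q * q ≤ N → isKey es q = true ∨ keyDvd es q = true := by
  intro fuel
  induction fuel with
  | zero =>
    intro p h q hpq hq
    rw [spGo, blt_true_iff, nat_mul_eq] at h
    have : p * p ≤ q * q := Nat.mul_le_mul hpq hpq
    omega
  | succ fuel ih =>
    intro p h q hpq hq
    rw [spGo] at h
    simp only [nat_mul_eq, nat_add_eq] at h
    cases hb : Nat.blt N (p * p) with
    | true =>
      rw [blt_true_iff] at hb
      have : p * p ≤ q * q := Nat.mul_le_mul hpq hpq
      omega
    | false =>
      rw [hb, cond_false, Bool.and_eq_true, Bool.or_eq_true] at h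
      rcases eq_or_lt_of_le hpq with rfl | hlt
      · exact h.1
      · exact ih (p + 1) h.2 q hlt hq

/-- **`smallPrimesIn` is sound**: if the keys are primes, every prime `p` with `p² ≤ N` is a key.
[folklore] -/
theorem smallPrimesIn_sound {N : ℕ} {es : List (ℕ × ℤ × ℤ × ℕ)} (h : smallPrimesIn N es = true)
    (hprime : ∀ q ∈ es.map (·.1), q.Prime) : ∀ p : ℕ, p.Prime → p * p ≤ N → p ∈ es.map (·.1) := by
  intro p hp hpN
  rcases spGo_sound N es N 2 h p hp.two_le hpN with hk | hk
  · exact (isKey_iff es p).1 hk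
  · obtain ⟨q, hq, hqp⟩ := (keyDvd_iff es p).1 hk
    have hqp' : q = p := ((Nat.prime_dvd_prime_iff_eq (hprime q hq) hp).1 hqp)
    rwa [← hqp']

/-! ### The common denominator -/

/-- `bigM N es > 0` when all keys and denominators are positive. [folklore] -/
theorem bigM_pos (N : ℕ) : ∀ es : List (ℕ × ℤ × ℤ × ℕ), (∀ e ∈ es, 0 < e.1 ∧ 0 < e.2.2.2) →
    0 < bigM N es := by
  intro es
  induction es with
  | nil => intro _; simp [bigM]
  | cons e es ih =>
    intro h
    obtain ⟨p, x, y, d⟩ := e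
    rw [bigM]
    simp only [nat_mul_eq, nat_pow_eq']
    have hp := (h (p, x, y, d) (by simp))
    refine Nat.mul_pos (pow_pos (Nat.mul_pos hp.2 hp.1) _) (ih fun e he ↦ h e (by simp [he]))

end Literature.Barriers.RiemannHypothesis.TuranCheck
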